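import Summits.ABC.ABC.Theses.DefiniteXi
import Literature.NumberTheory.EllipticCurves.SerreFreyValuationProductProofs
import Literature.NumberTheory.Sieve.DivisorBound

/-!
# `EisensteinQuarantine` (stmt-ABC-15023, route ABC/DefiniteXi) is false under the Proth–Legendre depth law

Negative lemmas for the crux `Summit.ABC.ABC.Theses.DefiniteXi.EisensteinQuarantine`
(`sixPart ξ(E; N/N⁻, N⁻) ≤ C_ε N^ε · 𝓛`, `𝓛 = ∏_{q ∣ N, q ∤ N⁻} v_q(Δ_min)`), filed `--negative-modulo ProthDepthFamily`
by the line lead of crux line `Sketch` (2026-08-16).  They make the census kill of the crux (ideator census kit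
j016666, direct Brandt census kit j017527 of the cdisprove seat, lead memo `Cruxes/EisensteinQuarantine/Lines/Sketch.md`)
kernel-checked down to ONE arithmetic input that the tree cannot yet construct:

* `ProthDepthFamily` (hypothesis `H`, census-true, NOT proved): for arbitrarily large `s` some prime `p ≡ 1 (mod 2^s)`
  with `p ≤ 2^{As}` has `2^s ≤ 2^c · ordProj[2] ξ(E_(−p, p−1); N/p, p)` — the 2-adic Eisenstein depth of Mazur's
  Eisenstein ideal of level `p` (index `num((p−1)/12)`, `2`-part `2^{s−2}`), absorbed by the Legendre point
  `y² = x(x−1)(x−p)` and visible in the quarantined congruence number (`v₂ ξ = s − 2` on all computed levels with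
  `s ≥ 8`).  It follows (`prothDepthFamily_of_prothDepthLaw`) from the uniform law `ProthDepthLaw` (all Proth primes)
  and Linnik's theorem `P(q) ≤ C q^L` (taken as a displayed hypothesis; not in the tree).  A proof of either law needs
  Jacquet–Langlands/Eichler for `brandtXi`, the `ℓ = 2` Eisenstein theory of prime level and level raising to
  `N⁺ = 2·rad((p−1)/2^s)` — none of which is in the tree.

Everything else is discharged here: the Frey data `N = rad(p(p−1))`, `v_q(Δ_min) = 2v_q(p(p−1)) − 8[q=2]` come from
the tree's PROVED Serre normalisation (`conductorNorm_freyCurve_serre`,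
`factorization_minimalDiscriminantNorm_freyCurve_serre`), and the allowance at `N⁻ = p` is bounded by the tree's
divisor bound: `𝓛 ≤ τ((p−1)²) ≤ C_δ p^{2δ}` (`Literature.NumberTheory.Sieve.exists_card_divisors_le_mul_rpow`).
With `ε = δ = 1/(8A)` the crux would give `2^s ≤ 2^c · C · C_δ · p^{1/(2A)} ≤ K · 2^{s/2}` along `p ≤ 2^{As}`,
absurd.  So any TRUE restatement of the crux must charge the Eisenstein index of the quarantined primes
(cf. the sign-blind repair C″ in `Lines/Sketch.md` §4), not only the level-lowering content `𝓛`.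

Main results: `EisensteinQuarantine_false_of_ProthDepthFamily : ProthDepthFamily → ¬ EisensteinQuarantine` and
`EisensteinQuarantine_false_of_ProthDepthLaw : (Linnik) → ProthDepthLaw → ¬ EisensteinQuarantine`.

## References

* [Mazur1977] B. Mazur, *Modular curves and the Eisenstein ideal*, Publ. Math. IHÉS 47 (1977) (index `n = num((p−1)/12)`).
* [Xylouris2011Linnik] T. Xylouris, Acta Arith. 150 (2011), §1.3 (1.5), Thm. 1.1 (Linnik's theorem, `L = 5.2`).
-/

-- `Summit.<Summit>.<Problem>`: for the single-conjunct summit `ABC` the duplicate `ABC.ABC` is mandated.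
set_option linter.dupNamespace false

noncomputable section

open scoped BigOperators
open Literature.NumberTheory.Automorphic Literature.NumberTheory.EllipticCurves
open Finset

namespace Summit.ABC.ABC.Theorems.EisensteinQuarantine.Negative

/-! ## The hypotheses -/

/-- **The Proth–Legendre 2-adic depth law, uniform form** (census-backed, NOT proved; kit j016666, j017464,
j017527): there is `c` such that for every prime `p` and every `s ≥ 5` with `2^s ∣ p − 1`, the 2-part of the
quarantined congruence number `ξ(E_(−p, p−1); N/p, p)` of the Frey curve of the triple `1 + (p−1) = p` (the Legendre
curve `y² = x(x−1)(x−p)`, conductor `N = rad(p(p−1))`) is at least `2^{s−c}`. -/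
def ProthDepthLaw : Prop :=
  ∃ c : ℕ, ∀ p s : ℕ, p.Prime → 5 ≤ s → 2 ^ s ∣ p - 1 →
    ∀ N : ℕ, (freyCurve (-(p : ℤ)) ((p - 1 : ℕ) : ℤ)).conductorNorm ℤ = N →
      2 ^ s ≤ 2 ^ c * ordProj[2] (brandtXi (N / p) p (fun n => (freyCurve (-(p : ℤ)) ((p - 1 : ℕ) : ℤ)).LFunction n))

/-- **Hypothesis `H` — the depth law along SOME polynomially sparse Proth family** (the weakest input the
refutation consumes; census-backed, NOT proved): there are `c, A` such that for arbitrarily large `s` some prime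
`p ≡ 1 (mod 2^s)` with `p ≤ 2^{A s}` has `2^s ≤ 2^c · ordProj[2] ξ(E_(−p, p−1); N/p, p)`.  It follows from the uniform
law `ProthDepthLaw` and Linnik's theorem (`prothDepthFamily_of_prothDepthLaw`); along the least primes
`p_s ≡ 1 (mod 2^s)` (`65537` at `s = 16`, …) it is exactly what the censuses measured. -/
def ProthDepthFamily : Prop :=
  ∃ c A : ℕ, ∀ s₀ : ℕ, ∃ s p : ℕ, s₀ ≤ s ∧ p.Prime ∧ 2 ^ s ∣ p - 1 ∧ p ≤ 2 ^ (A * s) ∧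
    ∀ N : ℕ, (freyCurve (-(p : ℤ)) ((p - 1 : ℕ) : ℤ)).conductorNorm ℤ = N →
      2 ^ s ≤ 2 ^ c * ordProj[2] (brandtXi (N / p) p (fun n => (freyCurve (-(p : ℤ)) ((p - 1 : ℕ) : ℤ)).LFunction n))

/-- **Uniform law + Linnik ⟹ `H`.**  Linnik's theorem (Linnik 1944; `L = 5.2`, Xylouris 2011, §1.3 (1.5) and
Thm. 1.1: the least prime `p ≡ a (mod q)` is `≤ C q^L`) is taken here as the displayed hypothesis `hLin`; with it the
uniform depth law gives the family with `A = C + L` (`C · 2^{sL} ≤ 2^{(C+L)s}` for `s ≥ 1`). [folklore] -/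
theorem prothDepthFamily_of_prothDepthLaw
    (hLin : ∃ L C : ℕ, ∀ q : ℕ, 1 ≤ q → ∀ a : ℕ, Nat.Coprime a q →
      ∃ p : ℕ, p.Prime ∧ p ≡ a [MOD q] ∧ p ≤ C * q ^ L)
    (hD : ProthDepthLaw) : ProthDepthFamily := by
  obtain ⟨L, C, hLC⟩ := hLin
  obtain ⟨c, hc⟩ := hD
  refine ⟨c, C + L, fun s₀ => ?_⟩
  set s : ℕ := max s₀ 5 with hs
  have hs5 : 5 ≤ s := le_max_right _ _
  obtain ⟨p, hp, hp1, hpC⟩ := hLC (2 ^ s) Nat.one_le_two_pow 1 (Nat.coprime_one_left _)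
  have hsp : 2 ^ s ∣ p - 1 := (Nat.modEq_iff_dvd' hp.one_lt.le).mp hp1.symm
  refine ⟨s, p, le_max_left _ _, hp, hsp, ?_, fun N hN => hc p s hp hs5 hsp N hN⟩
  have h1 : C ≤ 2 ^ (C * s) :=
    calc C ≤ 2 ^ C := Nat.lt_two_pow_self.le
      _ ≤ 2 ^ (C * s) := Nat.pow_le_pow_right (by norm_num) (Nat.le_mul_of_pos_right C (by omega))
  calc p ≤ C * (2 ^ s) ^ L := hpC
    _ ≤ 2 ^ (C * s) * (2 ^ s) ^ L := Nat.mul_le_mul_right _ h1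
    _ = 2 ^ ((C + L) * s) := by rw [← pow_mul, ← pow_add]; congr 1; ring

/-! ## Arithmetic lemmas -/

/-- `∏_{q ∣ M} 2 v_q(M) ≤ τ(M²)` (`τ(M²) = ∏ (2 v_q(M) + 1)`). [folklore] -/
theorem prod_two_mul_factorization_le_card_divisors_sq {M : ℕ} (hM : M ≠ 0) :
    ∏ q ∈ M.primeFactors, 2 * M.factorization q ≤ #(M ^ 2).divisors := by
  rw [Nat.card_divisors (pow_ne_zero 2 hM), Nat.primeFactors_pow _ two_ne_zero]
  refine prod_le_prod (fun _ _ => Nat.zero_le _) fun q _ => ?_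
  rw [Nat.factorization_pow]
  simp

/-- For a prime `p` and `q ∣ p − 1` prime: `v_q(p (p−1)) = v_q(p−1)`. [folklore] -/
theorem factorization_mul_pred_of_mem {p q : ℕ} (hp : p.Prime) (hq : q ∈ (p - 1).primeFactors) :
    (p * (p - 1)).factorization q = (p - 1).factorization q := by
  have hM0 : p - 1 ≠ 0 := by have := hp.two_le; omega
  have hqp : q ≠ p := by
    rintro rfl
    have h1 : q ∣ q - 1 := Nat.dvd_of_mem_primeFactors hq
    have h2 : q ≤ q - 1 := Nat.le_of_dvd (Nat.pos_of_ne_zero hM0) h1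
    have := hp.two_le
    omega
  rw [Nat.factorization_mul hp.ne_zero hM0, Finsupp.add_apply, hp.factorization, Finsupp.single_apply,
    if_neg (Ne.symm hqp), zero_add]

/-- The prime factors of `rad(p(p−1))` other than `p` are those of `p − 1`. [folklore] -/
theorem primeFactors_radical_mul_pred_sdiff {p : ℕ} (hp : p.Prime) :
    (UniqueFactorizationMonoid.radical (p * (p - 1))).primeFactors \ p.primeFactors = (p - 1).primeFactors := by
  have hM0 : p - 1 ≠ 0 := by have := hp.two_le; omega
  rw [Nat.primeFactors_radical, Nat.primeFactors_mul hp.ne_zero hM0, hp.primeFactors]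
  ext q
  simp only [mem_sdiff, mem_union, mem_singleton]
  constructor
  · rintro ⟨h | h, hq⟩
    · exact absurd h hq
    · exact h
  · intro h
    refine ⟨Or.inr h, ?_⟩
    rintro rfl
    have h1 : q ∣ q - 1 := Nat.dvd_of_mem_primeFactors h
    have h2 : q ≤ q - 1 := Nat.le_of_dvd (Nat.pos_of_ne_zero hM0) h1
    have := hp.two_le
    omega

/-! ## The conditional refutation -/

/-- **`EisensteinQuarantine` is false under `H`.**  At `ε = δ = 1/(8A)`, `N⁻ = p`, `(a, b) = (−p, p−1)` with
`p ≡ 1 (mod 2^s)`, `p ≤ 2^{As}` from the family: the crux and the depth inequality give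
`2^s ≤ 2^c · ordProj[2] ξ ≤ 2^c · C N^ε 𝓛 ≤ 2^c C C_δ p^{2ε+2δ} ≤ K · 2^{s/2}`, i.e. `2^s ≤ K²` — absurd for
`s` large. [folklore] -/
theorem EisensteinQuarantine_false_of_ProthDepthFamily (hD : ProthDepthFamily) :
    ¬ Summit.ABC.ABC.Theses.DefiniteXi.EisensteinQuarantine := by
  intro hEQ
  obtain ⟨c, A, hfam⟩ := hD
  -- exponents
  set A' : ℕ := max A 1 with hA'
  have hA'1 : 1 ≤ A' := le_max_right _ _
  have hA'R : (1 : ℝ) ≤ (A' : ℝ) := by exact_mod_cast hA'1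
  have hA'0 : (0 : ℝ) < (A' : ℝ) := by linarith
  have hAA' : (A : ℝ) ≤ (A' : ℝ) := by exact_mod_cast le_max_left A 1
  set t : ℝ := 1 / (8 * (A' : ℝ)) with ht
  have ht0 : 0 < t := by rw [ht]; positivity
  obtain ⟨C, hC⟩ := hEQ t ht0
  obtain ⟨Cd, hCd1, hCd⟩ := Literature.NumberTheory.Sieve.exists_card_divisors_le_mul_rpow ht0
  set C' : ℝ := max C 1 with hC'
  have hC'1 : 1 ≤ C' := le_max_right _ _
  have hC'0 : (0 : ℝ) ≤ C' := zero_le_one.trans hC'1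
  have hCd0 : (0 : ℝ) ≤ Cd := zero_le_one.trans hCd1
  -- the constant and the choice of `s`
  set K : ℝ := (2 : ℝ) ^ c * C' * Cd with hK
  have hK0 : 0 ≤ K := by rw [hK]; exact mul_nonneg (mul_nonneg (by positivity) hC'0) hCd0
  obtain ⟨n₀, hn₀⟩ := pow_unbounded_of_one_lt (K ^ 2) (by norm_num : (1 : ℝ) < 2)
  obtain ⟨s, p, hs₀, hp, hsp, hpA, hdep⟩ := hfam (max n₀ 5)
  have hs5 : 5 ≤ s := le_of_max_le_right hs₀
  have hKs : K ^ 2 < (2 : ℝ) ^ s := hn₀.trans_le (pow_le_pow_right₀ (by norm_num) (le_of_max_le_left hs₀))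
  have hp1le : 1 ≤ p := hp.one_lt.le
  have hM0 : p - 1 ≠ 0 := by have := hp.two_le; omega
  have h2s_le : 2 ^ s ≤ p - 1 := Nat.le_of_dvd (Nat.pos_of_ne_zero hM0) hsp
  have h32 : 2 ^ 5 ≤ p - 1 := (Nat.pow_le_pow_right (by norm_num) hs5).trans h2s_le
  norm_num at h32
  have hp2 : p ≠ 2 := by omega
  -- the Frey data `(a, b) = (−p, p−1)`
  set a : ℤ := -(p : ℤ) with ha
  set b : ℤ := ((p - 1 : ℕ) : ℤ) with hb
  have hpcast : (p : ℤ) = ((p - 1 : ℕ) : ℤ) + 1 := by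
    rw [Nat.cast_sub hp1le]; push_cast; ring
  have hab_sum : a + b = -1 := by rw [ha, hb, hpcast]; ring
  have habc : a * b * (a + b) = ((p * (p - 1) : ℕ) : ℤ) := by
    rw [hab_sum, ha, hb]; push_cast; ring
  have hPM0 : p * (p - 1) ≠ 0 := Nat.mul_ne_zero hp.ne_zero hM0
  have h0 : a * b * (a + b) ≠ 0 := by rw [habc]; exact_mod_cast hPM0
  have hab : IsCoprime a b := by
    rw [ha, hb, IsCoprime.neg_left_iff, Int.isCoprime_iff_gcd_eq_one, Int.gcd_natCast_natCast]
    exact (Nat.coprime_self_sub_right hp1le).mpr (Nat.coprime_one_right p)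
  have h4M : (4 : ℕ) ∣ p - 1 :=
    (Nat.pow_dvd_pow 2 (show 2 ≤ s by omega)).trans hsp
  have h32M : (32 : ℕ) ∣ p - 1 :=
    (Nat.pow_dvd_pow 2 hs5).trans hsp
  have ha4 : a ≡ -1 [ZMOD 4] := by
    have h4 : (4 : ℤ) ∣ b := by rw [hb]; exact_mod_cast h4M
    have : a = -1 - b := by rw [ha, hb, hpcast]; ring
    rw [this]
    calc -1 - b ≡ -1 - 0 [ZMOD 4] := Int.ModEq.sub_left _ ((Int.modEq_zero_iff_dvd).mpr h4)
      _ = -1 := by ring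
  have hb32 : (32 : ℤ) ∣ b := by rw [hb]; exact_mod_cast h32M
  have hnatAbs : (a * b * (a + b)).natAbs = p * (p - 1) := by rw [habc, Int.natAbs_natCast]
  -- the curve, its conductor and minimal discriminant
  set E := freyCurve a b with hE
  haveI : E.IsElliptic := isElliptic_freyCurve h0
  obtain ⟨N, hN⟩ : ∃ N : ℕ, E.conductorNorm ℤ = N := ⟨_, rfl⟩
  have hNval : N = UniqueFactorizationMonoid.radical (p * (p - 1)) := by
    rw [← hN, hE, conductorNorm_freyCurve_serre hab h0 ha4 hb32, hnatAbs]
  have hNpos : 0 < N := by rw [hNval]; exact Nat.radical_pos _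
  haveI : NeZero N := ⟨hNpos.ne'⟩
  have hNle : N ≤ p * (p - 1) := by rw [hNval]; exact Nat.radical_le_self_iff.mpr hPM0
  have hpN : p ∣ N := by
    rw [hNval]
    refine Nat.dvd_of_mem_primeFactors ?_
    rw [Nat.primeFactors_radical, Nat.primeFactors_mul hp.ne_zero hM0, hp.primeFactors]
    simp
  have hfac : ∀ q : ℕ, (E.minimalDiscriminantNorm ℤ).factorization q =
      2 * (p * (p - 1)).factorization q - if q = 2 then 8 else 0 := fun q => by
    rw [hE, factorization_minimalDiscriminantNorm_freyCurve_serre hab h0 ha4 hb32 q, hnatAbs]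
  -- admissibility of `Nm := p` and the crux at this instance
  have hPodd : Odd p := hp.odd_of_ne_two hp2
  have hPcard : Odd p.primeFactors.card := by rw [hp.primeFactors]; simp
  have hcrux := hC a b hab h0 N hN p hPodd hp.squarefree hPcard hpN
  obtain ⟨ξ, hξ⟩ : ∃ ξ : ℕ, brandtXi (N / p) p (fun n => E.LFunction n) = ξ := ⟨_, rfl⟩
  change ((ordProj[2] (brandtXi (N / p) p (fun n => E.LFunction n)) *
      ordProj[3] (brandtXi (N / p) p (fun n => E.LFunction n)) : ℕ) : ℝ) ≤
    C * (N : ℝ) ^ t * ((∏ q ∈ N.primeFactors \ p.primeFactors,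
      (E.minimalDiscriminantNorm ℤ).factorization q : ℕ) : ℝ) at hcrux
  rw [hξ] at hcrux
  -- the depth inequality at this instance
  have hdepth : 2 ^ s ≤ 2 ^ c * ordProj[2] ξ := by
    have h := hdep N hN
    change 2 ^ s ≤ 2 ^ c * ordProj[2] (brandtXi (N / p) p (fun n => E.LFunction n)) at h
    rwa [hξ] at h
  -- the allowance: 𝓛 ≤ τ((p−1)²)
  have hLtau : (∏ q ∈ N.primeFactors \ p.primeFactors, (E.minimalDiscriminantNorm ℤ).factorization q) ≤
      #((p - 1) ^ 2).divisors := by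
    have hsd : N.primeFactors \ p.primeFactors = (p - 1).primeFactors := by
      rw [hNval]; exact primeFactors_radical_mul_pred_sdiff hp
    rw [hsd]
    refine le_trans ?_ (prod_two_mul_factorization_le_card_divisors_sq hM0)
    refine prod_le_prod (fun _ _ => Nat.zero_le _) fun q hq => ?_
    rw [hfac q, factorization_mul_pred_of_mem hp hq]
    exact Nat.sub_le _ _
  -- pass to ℝ
  have hpR : (0 : ℝ) < (p : ℝ) := by exact_mod_cast hp.pos
  have hX0 : (0 : ℝ) ≤ ((ordProj[2] ξ : ℕ) : ℝ) := by positivity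
  have hY1 : (1 : ℝ) ≤ ((ordProj[3] ξ : ℕ) : ℝ) := by
    exact_mod_cast Nat.one_le_iff_ne_zero.mpr (Nat.ordProj_pos ξ 3).ne'
  have hNR : (0 : ℝ) < (N : ℝ) := by exact_mod_cast hNpos
  -- `N^t ≤ p^(2t)` and `τ ≤ Cd p^(2t)`
  have hp2R : ((p * (p - 1) : ℕ) : ℝ) ≤ (p : ℝ) ^ (2 : ℝ) := by
    rw [Real.rpow_two]
    have : p * (p - 1) ≤ p * p := Nat.mul_le_mul_left _ (Nat.sub_le _ _)
    calc ((p * (p - 1) : ℕ) : ℝ) ≤ ((p * p : ℕ) : ℝ) := by exact_mod_cast this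
      _ = (p : ℝ) ^ 2 := by push_cast; ring
  have hNt : (N : ℝ) ^ t ≤ (p : ℝ) ^ (2 * t) := by
    rw [Real.rpow_mul hpR.le]
    exact Real.rpow_le_rpow (Nat.cast_nonneg _) ((Nat.cast_le.mpr hNle).trans hp2R) ht0.le
  have hτ : (#((p - 1) ^ 2).divisors : ℝ) ≤ Cd * (p : ℝ) ^ (2 * t) := by
    have h1 := hCd ((p - 1) ^ 2) (pow_ne_zero 2 hM0)
    have h2 : ((((p - 1) ^ 2 : ℕ)) : ℝ) ≤ (p : ℝ) ^ (2 : ℝ) := by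
      rw [Real.rpow_two]; push_cast
      have : ((p - 1 : ℕ) : ℝ) ≤ (p : ℝ) := by exact_mod_cast Nat.sub_le p 1
      exact pow_le_pow_left₀ (Nat.cast_nonneg _) this 2
    calc (#((p - 1) ^ 2).divisors : ℝ) ≤ Cd * ((((p - 1) ^ 2 : ℕ)) : ℝ) ^ t := h1
      _ ≤ Cd * ((p : ℝ) ^ (2 : ℝ)) ^ t :=
          mul_le_mul_of_nonneg_left (Real.rpow_le_rpow (Nat.cast_nonneg _) h2 ht0.le) hCd0
      _ = Cd * (p : ℝ) ^ (2 * t) := by rw [Real.rpow_mul hpR.le]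
  -- `X ≤ C' · p^(2t) · Cd · p^(2t)`
  have hLR : ((∏ q ∈ N.primeFactors \ p.primeFactors, (E.minimalDiscriminantNorm ℤ).factorization q : ℕ) : ℝ) ≤
      Cd * (p : ℝ) ^ (2 * t) := (Nat.cast_le.mpr hLtau).trans hτ
  have hstep1 : ((ordProj[2] ξ : ℕ) : ℝ) ≤ C' * (p : ℝ) ^ (2 * t) * (Cd * (p : ℝ) ^ (2 * t)) := by
    have hL0 : (0 : ℝ) ≤ ((∏ q ∈ N.primeFactors \ p.primeFactors,
        (E.minimalDiscriminantNorm ℤ).factorization q : ℕ) : ℝ) := by positivity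
    calc ((ordProj[2] ξ : ℕ) : ℝ) ≤ ((ordProj[2] ξ : ℕ) : ℝ) * ((ordProj[3] ξ : ℕ) : ℝ) :=
          le_mul_of_one_le_right hX0 hY1
      _ = ((ordProj[2] ξ * ordProj[3] ξ : ℕ) : ℝ) := by push_cast; ring
      _ ≤ C * (N : ℝ) ^ t * ((∏ q ∈ N.primeFactors \ p.primeFactors,
            (E.minimalDiscriminantNorm ℤ).factorization q : ℕ) : ℝ) := hcrux
      _ ≤ C' * (N : ℝ) ^ t * ((∏ q ∈ N.primeFactors \ p.primeFactors,
            (E.minimalDiscriminantNorm ℤ).factorization q : ℕ) : ℝ) :=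
          mul_le_mul_of_nonneg_right
            (mul_le_mul_of_nonneg_right (le_max_left C 1) (Real.rpow_nonneg hNR.le _)) hL0
      _ ≤ C' * (p : ℝ) ^ (2 * t) * (Cd * (p : ℝ) ^ (2 * t)) :=
          mul_le_mul (mul_le_mul_of_nonneg_left hNt hC'0) hLR hL0
            (mul_nonneg hC'0 (Real.rpow_nonneg hpR.le _))
  -- `p^(4t) ≤ 2^(s/2)` along the family (`p ≤ 2^(A s)`, `4 t A ≤ 1/2`)
  have hp4t : (p : ℝ) ^ (2 * t) * (p : ℝ) ^ (2 * t) = (p : ℝ) ^ (4 * t) := by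
    rw [← Real.rpow_add hpR]; ring_nf
  set u : ℝ := (2 : ℝ) ^ ((s : ℝ) / 2) with hu
  have hu0 : 0 < u := by rw [hu]; positivity
  have huu : u * u = (2 : ℝ) ^ s := by
    rw [hu, ← Real.rpow_add (by norm_num : (0 : ℝ) < 2), ← Real.rpow_natCast (2 : ℝ) s]
    congr 1; ring
  have hpbound : (p : ℝ) ≤ (2 : ℝ) ^ (A * s) := by exact_mod_cast hpA
  have hexp_le : ((A * s : ℕ) : ℝ) * (4 * t) ≤ (s : ℝ) / 2 := by
    have hA'ne : (A' : ℝ) ≠ 0 := hA'0.ne'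
    have h1 : ((A * s : ℕ) : ℝ) * (4 * t) = (A : ℝ) / A' * ((s : ℝ) / 2) := by
      rw [ht]; push_cast; field_simp; ring
    rw [h1]
    exact mul_le_of_le_one_left (by positivity) ((div_le_one hA'0).mpr hAA')
  have hp4bound : (p : ℝ) ^ (4 * t) ≤ u := by
    have h4t : 0 ≤ 4 * t := by positivity
    calc (p : ℝ) ^ (4 * t) ≤ ((2 : ℝ) ^ (A * s)) ^ (4 * t) := Real.rpow_le_rpow hpR.le hpbound h4t
      _ = (2 : ℝ) ^ (((A * s : ℕ) : ℝ) * (4 * t)) := by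
          rw [← Real.rpow_natCast (2 : ℝ) (A * s), ← Real.rpow_mul (by norm_num : (0 : ℝ) ≤ 2)]
      _ ≤ (2 : ℝ) ^ ((s : ℝ) / 2) := Real.rpow_le_rpow_of_exponent_le (by norm_num) hexp_le
      _ = u := by rw [hu]
  -- combine: `u² = 2^s ≤ K · u`, so `2^s ≤ K²`, contradicting the choice of `s`
  have hdepthR : (2 : ℝ) ^ s ≤ (2 : ℝ) ^ c * ((ordProj[2] ξ : ℕ) : ℝ) := by exact_mod_cast hdepth
  have hfinal : (2 : ℝ) ^ s ≤ K * u := by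
    calc (2 : ℝ) ^ s ≤ (2 : ℝ) ^ c * ((ordProj[2] ξ : ℕ) : ℝ) := hdepthR
      _ ≤ (2 : ℝ) ^ c * (C' * (p : ℝ) ^ (2 * t) * (Cd * (p : ℝ) ^ (2 * t))) :=
          mul_le_mul_of_nonneg_left hstep1 (by positivity)
      _ = (2 : ℝ) ^ c * C' * Cd * (p : ℝ) ^ (4 * t) := by rw [← hp4t]; ring
      _ ≤ (2 : ℝ) ^ c * C' * Cd * u := mul_le_mul_of_nonneg_left hp4bound hK0
      _ = K * u := by rw [hK]
  rw [← huu] at hfinal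
  have huK : u ≤ K := le_of_mul_le_mul_right hfinal hu0
  have hsq : (2 : ℝ) ^ s ≤ K ^ 2 := by
    rw [← huu, sq]
    exact mul_le_mul huK huK hu0.le hK0
  linarith

/-- **`EisensteinQuarantine` is false under the uniform Proth–Legendre depth law**, given Linnik's theorem on
the least prime in an arithmetic progression (displayed hypothesis `hLin`: Linnik 1944; Heath-Brown 1992, `L = 5.5`;
Xylouris 2011, `L = 5.2`, §1.3 (1.5) and Thm. 1.1). [folklore] -/
theorem EisensteinQuarantine_false_of_ProthDepthLaw
    (hLin : ∃ L C : ℕ, ∀ q : ℕ, 1 ≤ q → ∀ a : ℕ, Nat.Coprime a q →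
      ∃ p : ℕ, p.Prime ∧ p ≡ a [MOD q] ∧ p ≤ C * q ^ L)
    (hD : ProthDepthLaw) : ¬ Summit.ABC.ABC.Theses.DefiniteXi.EisensteinQuarantine :=
  EisensteinQuarantine_false_of_ProthDepthFamily (prothDepthFamily_of_prothDepthLaw hLin hD)

end Summit.ABC.ABC.Theorems.EisensteinQuarantine.Negative
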